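import Summits.QuantumAdvantage.AdviceFreeQNC0.CodegTwoSyndrome
import HarnessLib

/-!
# Cell qa-qnc0 (rung F-S1, route RingFrame, crux α, line `tensor`): R1U at co-degree two, part 2 —
# rows, leaders, the row-syndrome space and its dimension

For a matrix `X : BMat L (d+3)` with LINEAR columns and a matrix `Y` with rows in `RM(d, d+3)` at
row distance `≤ w ≤ 4` (the hypotheses of `LiftOneUAt 3 K`):

* `CodegTwo.rowZ`, `CodegTwo.leader` — the `𝔽₂`-row `X(u,·)` and its LEADER (the columns where
  `X(u,·) ≠ Y(u,·)`, `#leader = rowDist`); `syn2_rowZ`: the order-`≤ 2` syndrome of a row is that of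
  its leader (`Syndrome2.ker_syn2_eq_lowDeg`).
* `CodegTwo.V` — the ROW-SYNDROME SPACE `syn2 (span of rows)`; since the columns of `X` are linear the
  rows form a subspace, so every element of `V` is the syndrome of an actual row
  (`exists_row_of_mem_V`), hence of a leader with `≤ w` points.
* `CodegTwo.finrank_ker_le` — the kernel of the parity/point-sum map `parity1` on `V` has dimension
  `≤ 2m` (`m = d + 3`): its elements are syndromes of leaders of even size and zero point-sum, i.e.
  (`≤ 4` points) of the empty set or a zero-sum quadruple, whose moment matrices have rank `≤ 2`
  (`Syndrome2.rank_momMat_le_two`) — MESHULAM (`Syndrome2.finrank_le_two_mul`); it is `0` for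
  `w ≤ 3` (`Syndrome2.eq_empty_of_card_le_three`).
* `CodegTwo.finrank_V_le` — **`dim V ≤ (m + 1) + 2m`** (`≤ m + 1` for `w ≤ 3`).

Part 3 (`CodegTwo.lean`) builds the lift and proves THEOREM E2.  The cell's lemmas (planner
qa-qnc0-p2 gen 5 ROUND-5 §2.2; prover qa-qnc0-prover gen 6, 2026-08-27).  WHAT THIS IS NOT: no
transversal/STAR bound; nothing on α or the separation.

## References

* R. Meshulam, *On the maximal rank in a subspace of matrices*, Quart. J. Math. Oxford 36 (1985)
  225–229, Thm 2 [Meshulam1985] (through `Syndrome2.finrank_le_two_mul`).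
-/

noncomputable section

namespace Summit.QuantumAdvantage.AdviceFreeQNC0

open Finset Module
open Literature.Computability.MetaComplexity Literature.Computability.MetaComplexity.Smolensky
open MeanLoad Syndrome2

namespace CodegTwo

variable {L d : ℕ}

/-! ### Rows, leaders, the row-syndrome space -/

/-- the `𝔽₂`-row of `X` at `u`. -/
def rowZ (X : BMat L (d + 3)) (u : Fin L → Bool) : CubeFn (ZMod 2) (d + 3) :=
  fun v => if X u v = true then 1 else 0

/-- the LEADER of row `u`: the columns where `X` and `Y` differ (`#leader = rowDist`). -/
def leader (X Y : BMat L (d + 3)) (u : Fin L → Bool) : Finset (Fin (d + 3) → Bool) :=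
  univ.filter fun v => X u v ≠ Y u v

/-- `#leader = rowDist`. -/
theorem card_leader (X Y : BMat L (d + 3)) (u : Fin L → Bool) : (leader X Y u).card = rowDist X Y u :=
  rfl

/-- `X(u,·) = Y(u,·) + 𝟙_{leader}` in `𝔽₂`. -/
theorem rowZ_eq_add_indF (X Y : BMat L (d + 3)) (u : Fin L → Bool) :
    rowZ X u = rowZ Y u + indF (leader X Y u) := by
  funext v
  unfold rowZ indF leader
  simp only [Finset.mem_filter, Finset.mem_univ, true_and, Pi.add_apply]
  cases X u v <;> cases Y u v <;> decide

/-- **The syndrome of a row is the syndrome of its leader** (the degree-`d` part is in the kernel). -/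
theorem syn2_rowZ {X Y : BMat L (d + 3)} (hY : RowsDeg d Y) (u : Fin L → Bool) :
    syn2 (rowZ X u) = syn2 (indF (leader X Y u)) := by
  rw [rowZ_eq_add_indF X Y u, map_add]
  have h : rowZ Y u ∈ LinearMap.ker (syn2 (m := d + 3)) := by
    rw [ker_syn2_eq_lowDeg]
    exact hY u
  rw [LinearMap.mem_ker] at h
  rw [h, zero_add]

/-- Rows of a matrix with linear columns are additive. -/
theorem rowZ_bx {X : BMat L (d + 3)} (hX : LinCols X) (u u' : Fin L → Bool) :
    rowZ X (bx u u') = rowZ X u + rowZ X u' := by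
  funext v
  show (if X (bx u u') v = true then (1 : ZMod 2) else 0) = _
  rw [apply_bx_of_linCols hX u u' v, ind_xor]
  rfl

/-- The row at `u = 0` vanishes (linear columns). -/
theorem rowZ_zero {X : BMat L (d + 3)} (hX : LinCols X) : rowZ X (fun _ => false) = 0 := by
  funext v
  show (if X (fun _ => false) v = true then (1 : ZMod 2) else 0) = 0
  rw [hX.2 v]
  rfl

/-- **The row-syndrome space** `V = syn2 (span of the rows of X)`. -/
def V (X : BMat L (d + 3)) : Submodule (ZMod 2) (Finset (Fin (d + 3)) → ZMod 2) :=
  (Submodule.span (ZMod 2) (Set.range (rowZ X))).map syn2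

/-- Row syndromes lie in `V`. -/
theorem syn2_rowZ_mem (X : BMat L (d + 3)) (u : Fin L → Bool) : syn2 (rowZ X u) ∈ V X :=
  Submodule.mem_map_of_mem (Submodule.subset_span ⟨u, rfl⟩)

/-- Every element of the span of the rows is a row (the rows form a subspace, as the columns of
`X` are linear). -/
theorem exists_row_of_mem_span {X : BMat L (d + 3)} (hX : LinCols X) {g : CubeFn (ZMod 2) (d + 3)}
    (hg : g ∈ Submodule.span (ZMod 2) (Set.range (rowZ X))) : ∃ u, rowZ X u = g := by
  induction hg using Submodule.span_induction with
  | mem g hg =>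
    obtain ⟨u, rfl⟩ := hg
    exact ⟨u, rfl⟩
  | zero => exact ⟨fun _ => false, rowZ_zero hX⟩
  | add g g' _ _ hg hg' =>
    obtain ⟨u, rfl⟩ := hg
    obtain ⟨u', rfl⟩ := hg'
    exact ⟨bx u u', rowZ_bx hX u u'⟩
  | smul c g _ hg =>
    obtain ⟨u, rfl⟩ := hg
    have hc : c = 0 ∨ c = 1 := by revert c; decide
    rcases hc with rfl | rfl
    · exact ⟨fun _ => false, by rw [rowZ_zero hX, zero_smul]⟩
    · exact ⟨u, by rw [one_smul]⟩

/-- **Every element of `V` is the syndrome of an actual row** (the rows form a subspace, as the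
columns of `X` are linear). -/
theorem exists_row_of_mem_V {X : BMat L (d + 3)} (hX : LinCols X) {s : Finset (Fin (d + 3)) → ZMod 2}
    (hs : s ∈ V X) : ∃ u, syn2 (rowZ X u) = s := by
  obtain ⟨g, hg, rfl⟩ := Submodule.mem_map.1 hs
  obtain ⟨u, hu⟩ := exists_row_of_mem_span hX hg
  exact ⟨u, by rw [hu]⟩

/-! ### The dimension of the row-syndrome space -/

/-- the parity / point-sum coordinates of a syndrome (`none ↦ s_∅`, `some i ↦ s_{i}`). -/
def parity1 : (Finset (Fin (d + 3)) → ZMod 2) →ₗ[ZMod 2] (Option (Fin (d + 3)) → ZMod 2) where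
  toFun s o := Option.elim o (s ∅) (fun i => s {i})
  map_add' s t := by funext o; cases o <;> rfl
  map_smul' c s := by funext o; cases o <;> rfl

variable {X Y : BMat L (d + 3)} {w : ℕ}

/-- A syndrome in `V` with zero parity and zero point sums comes from a leader of even size and zero
point-sum. -/
private theorem leader_of_mem_ker (hX : LinCols X) (hY : RowsDeg d Y) {s : Finset (Fin (d + 3)) → ZMod 2}
    (hs : s ∈ V X) (h0 : s ∅ = 0) (h1 : ∀ i, s {i} = 0) :
    ∃ u, s = syn2 (indF (leader X Y u)) ∧ Even (leader X Y u).card ∧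
      ∀ i, ∑ v ∈ leader X Y u, bvec v i = 0 := by
  obtain ⟨u, rfl⟩ := exists_row_of_mem_V hX hs
  refine ⟨u, syn2_rowZ hY u, ?_, fun i => ?_⟩
  · rw [syn2_rowZ hY u, syn2_indF_empty] at h0
    exact (ZMod.natCast_eq_zero_iff_even).1 h0
  · have h := h1 i
    rw [syn2_rowZ hY u, syn2_indF_singleton] at h
    exact h

/-- **The kernel of the parity/point-sum map on `V` has dimension `≤ 2m`** (radius `w ≤ 4`;
Meshulam), and is trivial for `w ≤ 3`. -/
theorem finrank_ker_le (hX : LinCols X) (hY : RowsDeg d Y) (hdist : ∀ u, rowDist X Y u ≤ w)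
    (hw4 : w ≤ 4) :
    finrank (ZMod 2) (LinearMap.ker (parity1.domRestrict (V X))) ≤
      (if w ≤ 3 then 0 else 2 * (d + 3)) := by
  set K := (LinearMap.ker (parity1.domRestrict (V X))).map (V X).subtype with hK
  have hKeq : finrank (ZMod 2) K = finrank (ZMod 2) (LinearMap.ker (parity1.domRestrict (V X))) :=
    Submodule.finrank_map_subtype_eq _ _
  rw [← hKeq]
  -- what membership in `K` means
  have hmem : ∀ s ∈ K, s ∈ V X ∧ s ∅ = 0 ∧ ∀ i, s {i} = 0 := by
    intro s hs
    rw [hK, Submodule.mem_map] at hs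
    obtain ⟨⟨s', hs'V⟩, hker, rfl⟩ := hs
    rw [LinearMap.mem_ker, LinearMap.domRestrict_apply] at hker
    refine ⟨hs'V, ?_, fun i => ?_⟩
    · exact congrFun hker none
    · exact congrFun hker (some i)
  split_ifs with hw3
  · -- `w ≤ 3`: every element of `K` is zero
    rw [Nat.le_zero, Submodule.finrank_eq_zero]
    rw [Submodule.eq_bot_iff]
    intro s hs
    obtain ⟨hsV, h0, h1⟩ := hmem s hs
    obtain ⟨u, rfl, heven, hσ⟩ := leader_of_mem_ker hX hY hsV h0 h1
    have hle : (leader X Y u).card ≤ 3 := (hdist u).trans hw3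
    rw [eq_empty_of_card_le_three _ hle heven hσ]
    have : indF (∅ : Finset (Fin (d + 3) → Bool)) = 0 := by funext v; simp [indF]
    rw [this, map_zero]
  · -- `w = 4`: Meshulam
    refine finrank_le_two_mul K (fun s hs => (hmem s hs).2.1) (fun s hs J hJ => ?_) (fun s hs => ?_)
    · obtain ⟨u, rfl⟩ := exists_row_of_mem_V hX (hmem s hs).1
      exact syn2_apply_of_gt _ hJ
    · obtain ⟨hsV, h0, h1⟩ := hmem s hs
      obtain ⟨u, rfl, heven, hσ⟩ := leader_of_mem_ker hX hY hsV h0 h1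
      rw [momMat_syn2_indF]
      exact rank_momMat_le_two _ ((hdist u).trans hw4) heven hσ

/-- **`dim V ≤ (m + 1) + dim K`.** -/
theorem finrank_V_le (hX : LinCols X) (hY : RowsDeg d Y) (hdist : ∀ u, rowDist X Y u ≤ w) (hw4 : w ≤ 4) :
    finrank (ZMod 2) (V X) ≤ (d + 3 + 1) + (if w ≤ 3 then 0 else 2 * (d + 3)) := by
  have h := LinearMap.finrank_range_add_finrank_ker (parity1.domRestrict (V X))
  have hrange : finrank (ZMod 2) (LinearMap.range (parity1.domRestrict (V X))) ≤ d + 3 + 1 := by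
    refine (Submodule.finrank_le _).trans ?_
    rw [Module.finrank_fintype_fun_eq_card, Fintype.card_option, Fintype.card_fin]
  have hker := finrank_ker_le hX hY hdist hw4
  omega

end CodegTwo

end Summit.QuantumAdvantage.AdviceFreeQNC0

end
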